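import Summits.BirchSwinnertonDyer.Rank1Residual.X1.RankOneCertificateRowsSha
import Literature.NumberTheory.EllipticCurves.ShaIsogenyProofs
import Literature.NumberTheory.EllipticCurves.IsogenyDualProofs
import HarnessLib

/-!
# X1 ∩ {r = 1}, route R-CT₂: the `Ш[p]`-WITNESS in the shape a `φ`-descent certifies —
# a non-trivial kernel of `Ш(φ) : Ш(E′) → Ш(E″)` for an isogeny `φ` of degree `p`

HONEST FRAMING (cell `b2b-bsdres`, run/shared/lean/b2b/bsd-rank1-residual/, verbatim in every
file): the goal of the cell is to DELETE the COMBINATION-SHAPED residual classes of the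
Birch–Swinnerton-Dyer formula for ALL analytic-rank `≤ 1` elliptic curves over `ℚ` — "full BSD
formula for every rank `≤ 1` curve in class `C`" assembled STRICTLY from published theorems — so
that the rank-`≤ 1` remainder becomes exactly the CONSTRUCTION-SHAPED classes, which are TYPED
(missing-input `Prop`s), NOT attempted. This is not "finishing BSD". CLASS-OWNERS.md: row
"X1 (r = 1)" — research route; NO CLAIM BEYOND STATED CLASSES; no label change; PER-PAIR certificate
shape, not a class theorem; nothing is booked by this file; no preprint enters; NO definition, NO
named fact.

Unit `b2b-bsdres-x1a` (X1 prover A, gen 18). Sequel of `X1/RankOneCertificateRowsSha.lean`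
(p305160). WHAT. The route-R-CT₂ row of the lane offer (`class-closure/N1/OFFER-T-X1R1-RP1-x1a.md`
§10 v1.2; cell `371522j @3`) needs ONE non-zero element of `Ш(E′/ℚ)[p]`. What a `φ`-descent engine
(x1b's `desc3q`, kit j136107) actually certifies is `dim_𝔽_p Ш(E′)[φ] ≥ 1` for a rational
`p`-isogeny `φ : E′ → E″`, i.e. that `Ш(φ) : Ш(E′/ℚ) → Ш(E″/ℚ)` has a NON-TRIVIAL KERNEL
(`dim Sel^φ(E′) − dim E″(ℚ)/φE′(ℚ) ≥ 1`). §1 is the algebra, over any number field: since the dual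
isogenỳ `φ̂` exists for elliptic curves with `φ̂ ∘ φ = [deg φ]` (Silverman III.6.1(a), the tree's
THEOREM `Isogeny.exists_dual_of_isElliptic`), `ker Ш(φ) ⊆ Ш(E′)[deg φ]`
(`ker_shaMap_le_torsionBy` / `nsmul_eq_zero_of_galH1Map_eq_zero`, Milne *ADT* I.7.1(b) proof), so a
non-zero kernel element — or `1 < #ker Ш(φ)` — is a non-zero element of `Ш(E′)[p]` when
`deg φ = p`. §2 plugs this into the route-R-CT₂ records (p289683 at the pair, p305160 booking form):
`BSDp` for every curve of the class, Mazur's main conjecture and `#Ш(E′)[p^∞] = p²` at the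
certificate curve, from the two route-R certificates with defect `2` and `1 < #ker Ш(φ)`.
PUBLISHED inputs only (Wuthrich Thm. 16, BMS Thm. 1.7, Perrin-Riou 1987, Mazur–Tate `σ`,
modularity, GZK, Cassels–Tate A24, Cassels); no definition, no named fact.

References: [SilvermanAEC2009] Thm. III.6.1(a), Thm. X.4.14; [MilneADT2006] Lemma I.7.1(b),
Thm. I.7.3; [Wuthrich2014] Thm. 16; [BalakrishnanMullerStein2015] Thm. 1.7; [PerrinRiou1987] §1.4
Cor. 1.8; HOME/class-closure/N1/OFFER-T-X1R1-RP1-x1a.md §10 (v1.2), SHA3-WITNESS-371522j-x1b.tsv.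
-/

noncomputable section

open scoped Classical MatrixGroups ModularForm

open PowerSeries CongruenceSubgroup WeierstrassCurve Literature.NumberTheory.EllipticCurves
  Literature.NumberTheory.EllipticCurves.ModularForms
  Literature.NumberTheory.EllipticCurves.Wuthrich2014
  Literature.NumberTheory.EllipticCurves.Rank1Residual
  Summit.BirchSwinnertonDyer.BirchSwinnertonDyer.Theorems
  Summit.BirchSwinnertonDyer.BirchSwinnertonDyer.Theorems.Rank1ResidualX1Defs
  Summit.BirchSwinnertonDyer.Rank1Residual.X1.RankOneLeadingTermSqueeze

set_option autoImplicit false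

universe u

namespace Summit.BirchSwinnertonDyer.Rank1Residual.X1.RankOne

/-! ## §1. Algebra: a non-trivial kernel of `Ш(φ)`, `deg φ = p`, is a non-zero element of `Ш[p]` -/

section Algebra

variable {K : Type u} [Field K] [NumberField K] {W' W'' : WeierstrassCurve K}
  [W'.IsElliptic] [W''.IsElliptic]

/-- **A non-zero element of `ker Ш(φ)` is a non-zero element of `Ш(E′)[deg φ]`.** For an isogeny
`φ : E′ → E″` of elliptic curves over a number field and `z ∈ Ш(E′/K)`, `z ≠ 0`, with `Ш(φ) z = 0`:
`(deg φ) • z = 0` — because the dual isogeny `φ̂` (`φ̂ ∘ φ = [deg φ]`, Silverman III.6.1(a); the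
tree's theorem `Isogeny.exists_dual_of_isElliptic`) gives `Ш(φ̂) (Ш(φ) z) = (deg φ) • z`
(Milne *ADT* I.7.1(b), proof). [cite: SilvermanAEC2009, Thm. III.6.1(a)]
[cite: MilneADT2006, Ch. I Lemma 7.1(b) (proof), p. 96] -/
theorem exists_sha_torsion_of_shaMap_eq_zero (φ : Isogeny W' W'') {p : ℕ} (hdeg : φ.degree = p)
    {z : W'.sha} (hz : z ≠ 0)
    (hker : shaMap φ.toAddMonoidHom φ.equivariant φ.hasLocalPointsMaps_toAddMonoidHom z = 0) :
    ∃ x : W'.sha, x ≠ 0 ∧ p • x = 0 := by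
  obtain ⟨ψ, hψ⟩ := φ.exists_dual_of_isElliptic
  refine ⟨z, hz, ?_⟩
  have hc : galH1Map φ.toAddMonoidHom φ.equivariant (z : W'.galH1) = 0 := congrArg Subtype.val hker
  have hn : φ.degree • (z : W'.galH1) = 0 :=
    nsmul_eq_zero_of_galH1Map_eq_zero φ.toAddMonoidHom φ.equivariant ψ.toAddMonoidHom ψ.equivariant
      (n := φ.degree) (fun P ↦ hψ P) hc
  rw [hdeg] at hn
  exact Subtype.ext (by exact_mod_cast hn)

/-- **`1 < #ker Ш(φ)` (i.e. `dim Ш(E′)[φ] ≥ 1`, what a `φ`-descent certifies as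
`dim Sel^φ(E′) − dim E″(K)/φE′(K) ≥ 1`) gives a non-zero element of `Ш(E′)[deg φ]`.**
[cite: SilvermanAEC2009, Thm. III.6.1(a)] [cite: MilneADT2006, Ch. I Lemma 7.1(b) (proof), p. 96] -/
theorem exists_sha_torsion_of_one_lt_card_ker_shaMap (φ : Isogeny W' W'') {p : ℕ}
    (hdeg : φ.degree = p)
    (hker : 1 < Nat.card
      (shaMap φ.toAddMonoidHom φ.equivariant φ.hasLocalPointsMaps_toAddMonoidHom).ker) :
    ∃ x : W'.sha, x ≠ 0 ∧ p • x = 0 := by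
  set Φ := shaMap φ.toAddMonoidHom φ.equivariant φ.hasLocalPointsMaps_toAddMonoidHom with hΦ
  haveI : Finite Φ.ker := Nat.finite_of_card_ne_zero (by omega)
  have hnt : Nontrivial Φ.ker := Finite.one_lt_card_iff_nontrivial.mp hker
  obtain ⟨⟨z, hzk⟩, hz0⟩ := exists_ne (0 : Φ.ker)
  have hz : z ≠ 0 := fun h ↦ hz0 (Subtype.ext h)
  exact exists_sha_torsion_of_shaMap_eq_zero φ hdeg hz ((AddMonoidHom.mem_ker).mp hzk)

end Algebra

/-! ## §2. Route R-CT₂ with the witness read off a `φ`-descent -/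

variable {W : WeierstrassCurve ℚ} [W.IsElliptic] [W.IsGloballyMinimal] {p : ℕ} [Fact p.Prime]

/-- **Route R-CT₂, booking (isogeny) form, descent shape:** leaf pair `(E, p)`, a globally minimal
`E′ ∼ E` carrying the route-R certificates `ord_p(ϖ·[T¹]L_p) = vc ≠ 0`, `v ≤ ord_p Reg_p(E′)` with
the DEFECT-`2` squeeze, and a rational isogeny `φ : E′ → E″` of degree `p` whose `Ш(φ)` has a
non-trivial kernel (`1 < #ker Ш(φ)`, a `φ`-descent) ⇒ `BSD(E,p)`. Via §1 and p305160's
`Leaf.bsdp_of_isIsogenous_of_regulatorGE_of_casselsTate_of_exists_torsion`. The kernel form of the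
lane-offer row `371522j @3` (`E′ = 371522j1`, `E″ = 371522j2`, `φ` the `3`-isogeny with kernel
`x₀ = −36`, `dim_𝔽₃ Ш(E′)[φ] = 1`). [cite: Wuthrich2014, Thm. 16 (p. 397)]
[cite: BalakrishnanMullerStein2015, Thm. 1.7] [cite: PerrinRiou1987, §1.4 Cor. 1.8]
[cite: SilvermanAEC2009, Thm. X.4.14] [cite: MilneADT2006, Thm. I.7.3] -/
theorem Leaf.bsdp_of_isIsogenous_of_regulatorGE_of_casselsTate_of_one_lt_card_ker_shaMap
    (hW16 : Wuthrich2014.charIdeal_dvd_padicLFunction) (hS : Schneider1985_order_charGenerator_odd)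
    (hPR : perrinRiou_rankOne_leadingTerms_odd) (hMT : mazur_tate_sigma_exists_odd)
    (hmod : nonempty_modularParametrizationData) (hmod' : hasEntireLFunction_rat)
    (hGZK : rank_eq_analyticRank_of_analyticRank_le_one) (hCassels : bsdRHS_eq_of_isIsogenous)
    (hCT : exists_casselsTate_pairing (K := ℚ))
    (hL : Leaf W p) {W' : WeierstrassCurve ℚ} [W'.IsElliptic] [W'.IsGloballyMinimal]
    (hiso : IsIsogenous W W') {vc : ℤ} (hvc : vc ≠ 0) (hc : AnalyticCoeffOneVal W' p vc)
    {v : ℤ} (hv : ∀ Dh : PAdicHeightData W' p, Dh.IsCanonical → v ≤ (padicRegulator Dh).valuation)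
    (hb : vc + 1 + 2 * padicValNat p W'.torsionOrder ≤
      v + padicValNat p W'.tamagawaProduct + 2 * padicValNat p (W'.reductionPointCount p) + 2)
    {W'' : WeierstrassCurve ℚ} [W''.IsElliptic] (φ : Isogeny W' W'') (hdeg : φ.degree = p)
    (hker : 1 < Nat.card
      (shaMap φ.toAddMonoidHom φ.equivariant φ.hasLocalPointsMaps_toAddMonoidHom).ker) :
    BSDp W p :=
  hL.bsdp_of_isIsogenous_of_regulatorGE_of_casselsTate_of_exists_torsion hW16 hS hPR hMT hmod hmod'
    hGZK hCassels hCT hiso hvc hc hv hb (exists_sha_torsion_of_one_lt_card_ker_shaMap φ hdeg hker)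

/-- **And at the certificate curve: Mazur's main conjecture, `BSD(E′,p)` and `#Ш(E′)[p^∞] = p²`
exactly**, from the same data (descent shape of p305160's
`Leaf.mazurMainConjecture_and_bsdp_and_card_of_isIsogenous_of_casselsTate_of_exists_torsion`).
[cite: Wuthrich2014, Thm. 16 (p. 397)] [cite: BalakrishnanMullerStein2015, Thm. 1.7]
[cite: PerrinRiou1987, §1.4 Cor. 1.8] [cite: SilvermanAEC2009, Thm. X.4.14] -/
theorem Leaf.mazurMainConjecture_and_bsdp_and_card_of_isIsogenous_of_casselsTate_of_one_lt_card_ker_shaMap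
    (hW16 : Wuthrich2014.charIdeal_dvd_padicLFunction) (hS : Schneider1985_order_charGenerator_odd)
    (hPR : perrinRiou_rankOne_leadingTerms_odd) (hMT : mazur_tate_sigma_exists_odd)
    (hmod : nonempty_modularParametrizationData) (hGZK : rank_eq_analyticRank_of_analyticRank_le_one)
    (hCT : exists_casselsTate_pairing (K := ℚ))
    (hL : Leaf W p) {W' : WeierstrassCurve ℚ} [W'.IsElliptic] [W'.IsGloballyMinimal]
    (hiso : IsIsogenous W W') {vc : ℤ} (hvc : vc ≠ 0) (hc : AnalyticCoeffOneVal W' p vc)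
    {v : ℤ} (hv : ∀ Dh : PAdicHeightData W' p, Dh.IsCanonical → v ≤ (padicRegulator Dh).valuation)
    (hb : vc + 1 + 2 * padicValNat p W'.torsionOrder ≤
      v + padicValNat p W'.tamagawaProduct + 2 * padicValNat p (W'.reductionPointCount p) + 2)
    {W'' : WeierstrassCurve ℚ} [W''.IsElliptic] (φ : Isogeny W' W'') (hdeg : φ.degree = p)
    (hker : 1 < Nat.card
      (shaMap φ.toAddMonoidHom φ.equivariant φ.hasLocalPointsMaps_toAddMonoidHom).ker) :
    MazurMainConjecture W' p ∧ BSDp W' p ∧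
      Nat.card (AddCommGroup.primaryComponent W'.sha p) = p ^ 2 :=
  hL.mazurMainConjecture_and_bsdp_and_card_of_isIsogenous_of_casselsTate_of_exists_torsion hW16 hS
    hPR hMT hmod hGZK hCT hiso hvc hc hv hb (exists_sha_torsion_of_one_lt_card_ker_shaMap φ hdeg hker)

/-- **The pair itself (`E = E′`): descent shape of p289683's Cassels–Tate theorem.**
[cite: Wuthrich2014, Thm. 16 (p. 397)] [cite: BalakrishnanMullerStein2015, Thm. 1.7]
[cite: PerrinRiou1987, §1.4 Cor. 1.8] [cite: SilvermanAEC2009, Thm. X.4.14] -/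
theorem Leaf.mazurMainConjecture_and_bsdp_of_regulatorGE_of_casselsTate_of_one_lt_card_ker_shaMap
    (hW16 : Wuthrich2014.charIdeal_dvd_padicLFunction) (hS : Schneider1985_order_charGenerator_odd)
    (hPR : perrinRiou_rankOne_leadingTerms_odd) (hMT : mazur_tate_sigma_exists_odd)
    (hmod : nonempty_modularParametrizationData) (hGZK : rank_eq_analyticRank_of_analyticRank_le_one)
    (hCT : exists_casselsTate_pairing (K := ℚ))
    (hL : Leaf W p) {vc : ℤ} (hvc : vc ≠ 0) (hc : AnalyticCoeffOneVal W p vc)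
    {v : ℤ} (hv : ∀ Dh : PAdicHeightData W p, Dh.IsCanonical → v ≤ (padicRegulator Dh).valuation)
    (hb : vc + 1 + 2 * padicValNat p W.torsionOrder ≤
      v + padicValNat p W.tamagawaProduct + 2 * padicValNat p (W.reductionPointCount p) + 2)
    {W'' : WeierstrassCurve ℚ} [W''.IsElliptic] (φ : Isogeny W W'') (hdeg : φ.degree = p)
    (hker : 1 < Nat.card
      (shaMap φ.toAddMonoidHom φ.equivariant φ.hasLocalPointsMaps_toAddMonoidHom).ker) :
    MazurMainConjecture W p ∧ BSDp W p ∧ Nat.card (AddCommGroup.primaryComponent W.sha p) = p ^ 2 :=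
  hL.mazurMainConjecture_and_bsdp_of_regulatorGE_of_casselsTate_of_exists_torsion hW16 hS hPR hMT
    hmod hGZK hCT hvc hc hv hb (exists_sha_torsion_of_one_lt_card_ker_shaMap φ hdeg hker)

end Summit.BirchSwinnertonDyer.Rank1Residual.X1.RankOne

end
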